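import Summits.Ventures.HSemireg.WedgeHankelSubstitution
import Summits.Ventures.HSemireg.WedgeHankelDivisorKernel

/-!
# Venture HSemireg — THE GENERAL LINEAR SUBSTITUTION (3): NODE CLASSES MOVE BY THE MÖBIUS MAP `λ ↦ (β + λδ)/(α + λγ)`, ORDERS KEPT —
# every substitution of a node class is a node class (at `∞` when `α + λγ = 0`), by an `LU` / `L·swap` factorization of the matrix; divisors follow by linearity

HONEST FRAMING. Part of the Lean index of the computation cell `pub-hsemireg` (seat p10 gen 18, Sunday typer «UNIFORM-IN-n»).
Finite-dimensional EXTERIOR ALGEBRA over a field ONLY: no variety, no cohomology theory, no sheaf, no Ext group, no semiregularity map;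
nothing here says that HC / HC_CM / HC_AV holds; no Literature fact is declared or used.  Custodian versions as in `WedgeHankelSiegelIdeal` (1/3) and `WedgeHankelFrameChange`;
the dictionary (a node-`λ` class of order `P + 1` = `exp(λΘ)·(polynomial of degree P)` ↦ `w_n(expMul λ q)`, `q` supported on `[0, P]`; the node at `∞` ↦ `w_n(rev_n q)`; the frame
substitution `(x, y) ↦ (αx + βy, γx + δy)` acts on the slope `λ` of the frame letter `x + λy ↦ (α + λγ)x + (β + λδ)y` by the Möbius map) is QUOTED, never asserted.

WHAT IS IN THE TREE.  H1 `WedgeHankelSubstitution` (this seat): `Sb`, `sbSeq`, `Sb_w`, `Sb_comp` / `Sb_Sb`, `Φs_eq_Sb`, `Ψs_eq_Sb`; E5 `Φs_w`, `Kr_w_expMul_of_order` (node `λ`: kernel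
`SI_k ⊔ Φs λ xRich(k,P)`); E7 `Ψs_w`, `Kr_w_rev_of_order` (node `∞`: `SI_k ⊔ yRich(k,P)`); F5 did each GENERATOR's action on a node (`w_rev_expMul`, `scaleSeq_expMul`,
`w_lowMul_expMul`, E9 `expMul_expMul`) and named «the PGL₂-action on divisors as one theorem» as NOT typed.  THIS FILE types it (namespace
`Summit.Ventures.HSemireg.Wedge.HankelFrameChange` continued):
* §129 LOWER-TRIANGULAR substitutions (`β = 0`: `x ↦ αx`, `y ↦ γx + δy`) keep the node `0` and the order: `sbSeq α 0 γ δ m q` is supported on `[0, P]` if `q` is, with top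
  coefficient `α^{m−P} δ^P q_P` (`sbSeq_lower_apply_eq_zero`, `sbSeq_lower_apply_self`).
* §130 the two factorizations of a substitution on the class side: **`Sb_eq_Φs_Sb_lower`** (`α ≠ 0`: `Sb α β γ δ = Φs (β/α) ∘ Sb α 0 γ ((αδ−βγ)/α)`, the `LU` factorization) and
  **`Sb_zero_eq_Ψs_Sb_lower`** (`Sb 0 β γ δ = Ψs ∘ Sb β 0 δ γ`).
* §131 A NODE AT `0`: **`Sb_w_eq_w_expMul`** (`α ≠ 0`: `Sb α β γ δ (w_n q) = w_n(expMul (β/α) q′)`, `q′` lower-triangular of `q`) and **`Kr_Sb_w_of_order`**: for `q` of exact order `P`,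
  `k + P ≤ n`, `αδ − βγ ≠ 0`: `Kr(univ, Sb α β γ δ (w_n q), k) = SI_k ⊔ Φs (β/α) (xRich(k,P))` — the node `0` goes to `β/α`, ORDER KEPT; `α = 0`: `Sb_zero_w_eq_w_rev`,
  **`Kr_Sb_zero_w_of_order`** (`= SI_k ⊔ yRich(k,P)`: the node goes to `∞`).
* §132 ANY NODE: `Sb_w_expMul` (`Sb α β γ δ (w_n(expMul λ q)) = Sb (α+λγ) (β+λδ) γ δ (w_n q)`), `Sb_w_rev` (`… (w_n(rev_n q)) = Sb γ δ α β (w_n q)`), hence **THE MÖBIUS THEOREM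
  `Kr_Sb_w_expMul_of_order`**: `α + λγ ≠ 0` ⇒ `Kr(univ, Sb α β γ δ (w_n(expMul λ q)), k) = SI_k ⊔ Φs ((β+λδ)/(α+λγ)) (xRich(k,P))` — the node `λ` goes to `(β+λδ)/(α+λγ)`, order
  kept (`Sb_w_expMul_eq_w_expMul` names the class); `α + λγ = 0` ⇒ `SI_k ⊔ yRich(k,P)` (to `∞`: `Kr_Sb_w_expMul_of_eq`); the node `∞` goes to `δ/γ` (`Kr_Sb_w_rev_of_order`, `γ ≠ 0`) or
  stays (`Kr_Sb_w_rev_of_eq`).  F5's four generator statements are the instances `(1,a,0,1)`, `(0,1,1,0)`, `(1,0,0,m)`, `(1,0,c,1)`.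
* §133 DIVISORS by linearity (F2b `w_finsum`): **`Sb_w_expMul_sum`** (all nodes stay finite: `Sb (w_n(Σ_i expMul λ_i q_i)) = w_n(Σ_i expMul λ′_i q′_i)` with `λ′_i` the Möbius images
  and `q′_i` of the same exact orders), and **`mobius_injective`** (distinct nodes stay distinct when `αδ − βγ ≠ 0`) — so every divisor law of the lineage (F2a–F2d, G4, G8, G9)
  applies verbatim to the image divisor.
NOT typed here: images `V` of the moved classes by name (F4b's `V_w_expMul_of_order_eq` applies to the right-hand sides verbatim); Hankel ranks (H1b: `rank_hankel1_sbSeq`);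
anything Ext-side.  Class side only; new names only.
-/

open Module

namespace Summit.Ventures.HSemireg.Wedge.HankelFrameChange

open Summit.Ventures.HSemireg.Wedge Summit.Ventures.HSemireg.Wedge.Kunneth Summit.Ventures.HSemireg.Wedge.Hankel
  Summit.Ventures.HSemireg.Wedge.BasisFree Summit.Ventures.HSemireg.Wedge.HankelSiegel Summit.Ventures.HSemireg.Wedge.HankelSiegelIdeal
  Summit.Ventures.HSemireg.Wedge.KunnethKernel Summit.Ventures.HSemireg.Wedge.HankelRankOne

variable (K : Type*) [Field K] {n : ℕ}

/-! ## §129. Lower-triangular substitutions keep the node `0` and the order -/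

/-- a LOWER-TRIANGULAR substitution (`β = 0`) reads `q_j, …, q_m` only: if `q` vanishes from `j` on, so does `sbSeq α 0 γ δ m q j`. -/
theorem sbSeq_lower_eq_zero (α γ δ : K) : ∀ (m : ℕ) (q : ℕ → K) (j : ℕ), (∀ i, j ≤ i → q i = 0) → sbSeq K α 0 γ δ m q j = 0
  | 0, _, 0, h => by rw [sbSeq_zero_zero]; exact h 0 le_rfl
  | 0, _, _ + 1, _ => rfl
  | m + 1, q, 0, h => by
    have hq : ∀ i, 0 ≤ i → shift K q i = 0 := fun i _ => h (i + 1) (Nat.zero_le _)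
    rw [sbSeq_succ_zero, sbSeq_lower_eq_zero α γ δ m q 0 h, sbSeq_lower_eq_zero α γ δ m (shift K q) 0 hq, mul_zero, mul_zero, add_zero]
  | m + 1, q, j + 1, h => by
    have hq : ∀ i, j ≤ i → shift K q i = 0 := fun i hi => h (i + 1) (by omega)
    rw [sbSeq_succ_succ, zero_mul, zero_add, sbSeq_lower_eq_zero α γ δ m (shift K q) j hq, mul_zero]

/-- … so a sequence supported on `[0, P]` stays supported on `[0, P]`. -/
theorem sbSeq_lower_apply_eq_zero (α γ δ : K) (m : ℕ) {P : ℕ} {q : ℕ → K} (hq : ∀ j, P < j → q j = 0) {j : ℕ} (hj : P < j) :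
    sbSeq K α 0 γ δ m q j = 0 :=
  sbSeq_lower_eq_zero K α γ δ m q j fun i hi => hq i (by omega)

/-- **… and its top coefficient is multiplied by `α^{m−P} δ^P`**: `sbSeq α 0 γ δ m q P = α^{m−P} δ^P q_P` (`q` supported on `[0, P]`, `P ≤ m`). -/
theorem sbSeq_lower_apply_self (α γ δ : K) :
    ∀ (m : ℕ) {P : ℕ} (q : ℕ → K), P ≤ m → (∀ j, P < j → q j = 0) → sbSeq K α 0 γ δ m q P = α ^ (m - P) * δ ^ P * q P
  | 0, 0, q, _, _ => by rw [sbSeq_zero_zero, pow_zero, pow_zero, one_mul, one_mul]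
  | m + 1, 0, q, _, hq => by
    have h0 : ∀ i, 0 ≤ i → shift K q i = 0 := fun i _ => hq (i + 1) (Nat.succ_pos i)
    rw [sbSeq_succ_zero, sbSeq_lower_eq_zero K α γ δ m (shift K q) 0 h0, mul_zero, add_zero, sbSeq_lower_apply_self α γ δ m q (Nat.zero_le _) hq,
      Nat.sub_zero, Nat.sub_zero, pow_zero, mul_one, mul_one, pow_succ]
    ring
  | m + 1, P + 1, q, hP, hq => by
    have hq' : ∀ j, P < j → shift K q j = 0 := fun j hj => hq (j + 1) (by omega)
    rw [sbSeq_succ_succ, zero_mul, zero_add, sbSeq_lower_apply_self α γ δ m (shift K q) (by omega) hq', shift_apply, Nat.succ_sub_succ, pow_succ]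
    ring

/-- the top coefficient stays non-zero when `α ≠ 0`, `δ ≠ 0`. -/
lemma sbSeq_lower_apply_self_ne_zero {α δ : K} (hα : α ≠ 0) (hδ : δ ≠ 0) (γ : K) (m : ℕ) {P : ℕ} {q : ℕ → K} (hP : P ≤ m) (hq : ∀ j, P < j → q j = 0)
    (hqP : q P ≠ 0) : sbSeq K α 0 γ δ m q P ≠ 0 := by
  rw [sbSeq_lower_apply_self K α γ δ m q hP hq]
  exact mul_ne_zero (mul_ne_zero (pow_ne_zero _ hα) (pow_ne_zero _ hδ)) hqP

/-! ## §130. The two factorizations -/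

/-- **`α ≠ 0`: `Sb α β γ δ = Φs (β/α) ∘ Sb α 0 γ ((αδ − βγ)/α)`** — an upper shear AFTER a lower-triangular substitution (`LU`; substitutions compose contravariantly). -/
theorem Sb_eq_Φs_Sb_lower {α : K} (hα : α ≠ 0) (β γ δ : K) (f : HT K (In n)) :
    Sb K α β γ δ f = Φs K (β / α) (Sb K α 0 γ ((α * δ - β * γ) / α) f) := by
  rw [← AlgEquiv.coe_toAlgHom, Φs_eq_Sb, Sb_Sb]
  have e1 : α * 1 + 0 * 0 = α := by ring
  have e2 : α * (β / α) + 0 * 1 = β := by rw [zero_mul, add_zero, mul_div_cancel₀ β hα]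
  have e3 : γ * 1 + (α * δ - β * γ) / α * 0 = γ := by ring
  have e4 : γ * (β / α) + (α * δ - β * γ) / α * 1 = δ := by field_simp; ring
  rw [e1, e2, e3, e4]

/-- **`α = 0`: `Sb 0 β γ δ = Ψs ∘ Sb β 0 δ γ`** — the swap after a lower-triangular substitution. -/
theorem Sb_zero_eq_Ψs_Sb_lower (β γ δ : K) (f : HT K (In n)) : Sb K 0 β γ δ f = Ψs K (Sb K β 0 δ γ f) := by
  rw [← AlgEquiv.coe_toAlgHom, Ψs_eq_Sb, Sb_Sb]
  simp only [mul_zero, mul_one, add_zero, zero_add]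

/-! ## §131. A node at `0` under a substitution -/

/-- **`Sb α β γ δ (w_n(q)) = w_n(expMul (β/α) (sbSeq α 0 γ ((αδ−βγ)/α) n q))`** for `α ≠ 0` and EVERY `q`: a class at the node `0` goes to a class at the node `β/α`. -/
theorem Sb_w_eq_w_expMul {α : K} (hα : α ≠ 0) (β γ δ : K) (q : ℕ → K) :
    Sb K α β γ δ (w K n n q) = w K n n (expMul K (β / α) (sbSeq K α 0 γ ((α * δ - β * γ) / α) n q)) := by
  rw [Sb_eq_Φs_Sb_lower K hα, Sb_w K α 0 γ _ le_rfl, Φs_w K _ le_rfl]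

/-- **THE NODE `0` GOES TO `β/α`, ORDER KEPT**: for `q` of exact order `P` (supported on `[0,P]`, `q_P ≠ 0`), `k + P ≤ n`, `α ≠ 0`, `αδ − βγ ≠ 0`:
`Kr(univ, Sb α β γ δ (w_n(q)), k) = SI_k ⊔ Φs (β/α) (xRich(k, P))` (E5's confluent kernel law at the new node). -/
theorem Kr_Sb_w_of_order {α β γ δ : K} (hα : α ≠ 0) (hdet : α * δ - β * γ ≠ 0) {k P : ℕ} (hkP : k + P ≤ n) {q : ℕ → K} (hq : ∀ j, P < j → q j = 0)
    (hqP : q P ≠ 0) : Kr K Finset.univ (Sb K α β γ δ (w K n n q)) k = siegelIdeal K n k ⊔ (xRich K n k P).map (Φs K (n := n) (β / α)).toLinearMap := by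
  rw [Sb_w_eq_w_expMul K hα]
  exact Kr_w_expMul_of_order K (β / α) hkP (fun j hj => sbSeq_lower_apply_eq_zero K α γ _ n hq hj)
    (sbSeq_lower_apply_self_ne_zero K hα (div_ne_zero hdet hα) γ n (by omega) hq hqP)

/-- **`α = 0`: `Sb 0 β γ δ (w_n(q)) = w_n(rev_n (sbSeq β 0 δ γ n q))`** — the class at the node `0` goes to a class at `∞`. -/
theorem Sb_zero_w_eq_w_rev (β γ δ : K) (q : ℕ → K) : Sb K 0 β γ δ (w K n n q) = w K n n (rev K n (sbSeq K β 0 δ γ n q)) := by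
  rw [Sb_zero_eq_Ψs_Sb_lower, Sb_w K β 0 δ γ le_rfl, Ψs_w K le_rfl]

/-- **… ORDER KEPT: `Kr(univ, Sb 0 β γ δ (w_n(q)), k) = SI_k ⊔ yRich(k, P)`** (`q` of exact order `P`, `k + P ≤ n`, `β ≠ 0`, `γ ≠ 0`; E7's kernel law at `∞`). -/
theorem Kr_Sb_zero_w_of_order {β γ : K} (hβ : β ≠ 0) (hγ : γ ≠ 0) (δ : K) {k P : ℕ} (hkP : k + P ≤ n) {q : ℕ → K} (hq : ∀ j, P < j → q j = 0) (hqP : q P ≠ 0) :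
    Kr K Finset.univ (Sb K 0 β γ δ (w K n n q)) k = siegelIdeal K n k ⊔ yRich K n k P := by
  rw [Sb_zero_w_eq_w_rev]
  exact Kr_w_rev_of_order K hkP (fun j hj => sbSeq_lower_apply_eq_zero K β δ γ n hq hj) (sbSeq_lower_apply_self_ne_zero K hβ hγ δ n (by omega) hq hqP)

/-! ## §132. Any node: the Möbius map -/

/-- a node-`λ` class under a substitution is the node-`0` class under the product substitution: **`Sb α β γ δ (w_n(expMul λ q)) = Sb (α+λγ) (β+λδ) γ δ (w_n(q))`**
(`Φs λ = Sb 1 λ 0 1` first, `Sb_comp`). -/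
theorem Sb_w_expMul (α β γ δ lam : K) (q : ℕ → K) :
    Sb K α β γ δ (w K n n (expMul K lam q)) = Sb K (α + lam * γ) (β + lam * δ) γ δ (w K n n q) := by
  rw [← Φs_w K lam le_rfl, ← AlgEquiv.coe_toAlgHom, Φs_eq_Sb, Sb_Sb]
  simp only [one_mul, zero_mul, zero_add]

/-- a node-`∞` class under a substitution: **`Sb α β γ δ (w_n(rev_n q)) = Sb γ δ α β (w_n(q))`** (`Ψs = Sb 0 1 1 0` first). -/
theorem Sb_w_rev (α β γ δ : K) (q : ℕ → K) : Sb K α β γ δ (w K n n (rev K n q)) = Sb K γ δ α β (w K n n q) := by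
  rw [← Ψs_w K le_rfl, ← AlgEquiv.coe_toAlgHom, Ψs_eq_Sb, Sb_Sb]
  simp only [one_mul, zero_mul, zero_add, add_zero]

/-- **THE CLASS: `Sb α β γ δ (w_n(expMul λ q)) = w_n(expMul ((β+λδ)/(α+λγ)) q′)`** with `q′ = sbSeq (α+λγ) 0 γ ((αδ−βγ)/(α+λγ)) n q` (`α + λγ ≠ 0`; `q′` has the support and,
for `αδ − βγ ≠ 0`, the exact order of `q`, §129). -/
theorem Sb_w_expMul_eq_w_expMul {α γ lam : K} (ha : α + lam * γ ≠ 0) (β δ : K) (q : ℕ → K) :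
    Sb K α β γ δ (w K n n (expMul K lam q)) =
      w K n n (expMul K ((β + lam * δ) / (α + lam * γ)) (sbSeq K (α + lam * γ) 0 γ ((α * δ - β * γ) / (α + lam * γ)) n q)) := by
  have e : (α + lam * γ) * δ - (β + lam * δ) * γ = α * δ - β * γ := by ring
  rw [Sb_w_expMul, Sb_w_eq_w_expMul K ha, e]

/-- **THE MÖBIUS THEOREM (kernels): a node-`λ` class of exact order `P` goes to a node-`(β+λδ)/(α+λγ)` class of exact order `P`** — for `α + λγ ≠ 0`, `αδ − βγ ≠ 0`, `k + P ≤ n`,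
`q` supported on `[0,P]` with `q_P ≠ 0`: `Kr(univ, Sb α β γ δ (w_n(expMul λ q)), k) = SI_k ⊔ Φs ((β+λδ)/(α+λγ)) (xRich(k,P))`.  F5's `w_rev_expMul` (`ν ↦ ν⁻¹`),
`scaleSeq_expMul` (`ν ↦ mν`), `w_lowMul_expMul` (`ν ↦ ν/(1+cν)`) and E9's `expMul_expMul` (`ν ↦ ν + a`) are the instances `(0,1,1,0)`, `(1,0,0,m)`, `(1,0,c,1)`, `(1,a,0,1)`. -/
theorem Kr_Sb_w_expMul_of_order {α β γ δ lam : K} (ha : α + lam * γ ≠ 0) (hdet : α * δ - β * γ ≠ 0) {k P : ℕ} (hkP : k + P ≤ n) {q : ℕ → K}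
    (hq : ∀ j, P < j → q j = 0) (hqP : q P ≠ 0) :
    Kr K Finset.univ (Sb K α β γ δ (w K n n (expMul K lam q))) k =
      siegelIdeal K n k ⊔ (xRich K n k P).map (Φs K (n := n) ((β + lam * δ) / (α + lam * γ))).toLinearMap := by
  rw [Sb_w_expMul]
  refine Kr_Sb_w_of_order K ha ?_ hkP hq hqP
  have e : (α + lam * γ) * δ - (β + lam * δ) * γ = α * δ - β * γ := by ring
  rwa [e]

/-- **`α + λγ = 0`: THE NODE `λ` GOES TO `∞`** — the class: `Sb α β γ δ (w_n(expMul λ q)) = w_n(rev_n (sbSeq (β+λδ) 0 δ γ n q))`. -/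
theorem Sb_w_expMul_eq_w_rev {α γ lam : K} (ha : α + lam * γ = 0) (β δ : K) (q : ℕ → K) :
    Sb K α β γ δ (w K n n (expMul K lam q)) = w K n n (rev K n (sbSeq K (β + lam * δ) 0 δ γ n q)) := by
  rw [Sb_w_expMul, ha, Sb_zero_w_eq_w_rev]

/-- … and the kernel: `Kr(univ, Sb α β γ δ (w_n(expMul λ q)), k) = SI_k ⊔ yRich(k, P)` (`α + λγ = 0`, `αδ − βγ ≠ 0`, exact order `P`, `k + P ≤ n`) — ORDER KEPT at `∞`. -/
theorem Kr_Sb_w_expMul_of_eq {α β γ δ lam : K} (ha : α + lam * γ = 0) (hdet : α * δ - β * γ ≠ 0) {k P : ℕ} (hkP : k + P ≤ n) {q : ℕ → K}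
    (hq : ∀ j, P < j → q j = 0) (hqP : q P ≠ 0) : Kr K Finset.univ (Sb K α β γ δ (w K n n (expMul K lam q))) k = siegelIdeal K n k ⊔ yRich K n k P := by
  have hγ : γ ≠ 0 := by
    rintro rfl
    exact hdet (by linear_combination δ * ha)
  have hb : β + lam * δ ≠ 0 := fun hb => hdet (by linear_combination δ * ha - γ * hb)
  rw [Sb_w_expMul, ha]
  exact Kr_Sb_zero_w_of_order K hb hγ δ hkP hq hqP

/-- **THE NODE `∞` GOES TO `δ/γ`** (`γ ≠ 0`, `αδ − βγ ≠ 0`): `Kr(univ, Sb α β γ δ (w_n(rev_n q)), k) = SI_k ⊔ Φs (δ/γ) (xRich(k, P))` for `q` of exact order `P`, `k + P ≤ n`. -/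
theorem Kr_Sb_w_rev_of_order {α β γ δ : K} (hγ : γ ≠ 0) (hdet : α * δ - β * γ ≠ 0) {k P : ℕ} (hkP : k + P ≤ n) {q : ℕ → K} (hq : ∀ j, P < j → q j = 0)
    (hqP : q P ≠ 0) : Kr K Finset.univ (Sb K α β γ δ (w K n n (rev K n q))) k = siegelIdeal K n k ⊔ (xRich K n k P).map (Φs K (n := n) (δ / γ)).toLinearMap := by
  rw [Sb_w_rev]
  refine Kr_Sb_w_of_order K hγ ?_ hkP hq hqP
  intro h; exact hdet (by linear_combination -h)

/-- **… or STAYS at `∞`** (`γ = 0`; then `α ≠ 0 ≠ δ`): `Kr(univ, Sb α β 0 δ (w_n(rev_n q)), k) = SI_k ⊔ yRich(k, P)`. -/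
theorem Kr_Sb_w_rev_of_eq {α δ : K} (hα : α ≠ 0) (hδ : δ ≠ 0) (β : K) {k P : ℕ} (hkP : k + P ≤ n) {q : ℕ → K} (hq : ∀ j, P < j → q j = 0) (hqP : q P ≠ 0) :
    Kr K Finset.univ (Sb K α β 0 δ (w K n n (rev K n q))) k = siegelIdeal K n k ⊔ yRich K n k P := by
  rw [Sb_w_rev]
  exact Kr_Sb_zero_w_of_order K hδ hα β hkP hq hqP

/-! ## §133. Divisors, by linearity -/

/-- **DIVISORS: `Sb α β γ δ (w_n(Σ_i expMul λ_i q_i)) = w_n(Σ_i expMul λ′_i q′_i)`** with `λ′_i = (β + λ_iδ)/(α + λ_iγ)` (all `α + λ_iγ ≠ 0`) and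
`q′_i = sbSeq (α+λ_iγ) 0 γ ((αδ−βγ)/(α+λ_iγ)) n q_i` (same supports; same exact orders when `αδ − βγ ≠ 0`, §129). -/
theorem Sb_w_expMul_sum {r : ℕ} (α β γ δ : K) (lam : Fin r → K) (q : Fin r → ℕ → K) (ha : ∀ i, α + lam i * γ ≠ 0) :
    Sb K α β γ δ (w K n n (fun j => ∑ i, expMul K (lam i) (q i) j)) =
      w K n n (fun j => ∑ i, expMul K ((β + lam i * δ) / (α + lam i * γ)) (sbSeq K (α + lam i * γ) 0 γ ((α * δ - β * γ) / (α + lam i * γ)) n (q i)) j) := by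
  rw [w_finsum, map_sum, w_finsum]
  exact Finset.sum_congr rfl fun i _ => Sb_w_expMul_eq_w_expMul K (ha i) β δ (q i)

/-- **THE MÖBIUS MAP IS INJECTIVE ON THE NODES IT KEEPS FINITE** (`αδ − βγ ≠ 0`): distinct nodes of a divisor stay distinct. -/
theorem mobius_injective {α β γ δ : K} (hdet : α * δ - β * γ ≠ 0) {lam mu : K} (ha : α + lam * γ ≠ 0) (hb : α + mu * γ ≠ 0)
    (h : (β + lam * δ) / (α + lam * γ) = (β + mu * δ) / (α + mu * γ)) : lam = mu := by
  rw [div_eq_div_iff ha hb] at h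
  have h2 : (lam - mu) * (α * δ - β * γ) = 0 := by linear_combination h
  rcases mul_eq_zero.mp h2 with h3 | h3
  · exact sub_eq_zero.mp h3
  · exact absurd h3 hdet

/-- so the image nodes of an injective node family form an injective family (hypotheses as above). -/
theorem mobius_comp_injective {α β γ δ : K} (hdet : α * δ - β * γ ≠ 0) {r : ℕ} {lam : Fin r → K} (hlam : Function.Injective lam) (ha : ∀ i, α + lam i * γ ≠ 0) :
    Function.Injective fun i => (β + lam i * δ) / (α + lam i * γ) :=
  fun i j h => hlam (mobius_injective K hdet (ha i) (ha j) h)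

end Summit.Ventures.HSemireg.Wedge.HankelFrameChange
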